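import Literature.Topology.FourManifolds.KhFrobeniusRMove
import Literature.Topology.FourManifolds.KhRMove
import Literature.Topology.FourManifolds.RasmussenWellDefinedR
import HarnessLib

/-!
# Khovanov homology, the homology over every Frobenius system and Rasmussen's `s` are knot invariants
# (modulo Reidemeister's theorem for the full oriented move set)

Knot-level form of `KhRMove.lean`, `KhFrobeniusRMove.lean`, `LeeRasmussenAntiBigonProofs.lean`: given
Reidemeister's theorem in its `RMove`/`REquiv` form (the named fact `Knot.reidemeisterR` of
`RasmussenWellDefinedR.lean`, of which only the direction `→` is used), regular projections of
ISOTOPIC knots read Gauss diagrams with isomorphic Khovanov homology, isomorphic homology over every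
Frobenius system `(R, h, t)` (Lee, Bar-Natan, `Kh_R`) and the same Rasmussen invariant. For ONE knot
and two of its projections the same conclusions hold unconditionally
(`LeeRasmussenReadUniqueProofs.lean`).

* `Knot.RegularProjection.nonempty_iso_khovanovHomology_of_isIsotopic`
* `Knot.RegularProjection.nonempty_iso_frobeniusHomology_of_isIsotopic`
* `Knot.RegularProjection.rasmussenInvariant_eq_of_isIsotopic`
* `Knot.HasGaussDiagram.nonempty_iso_khovanovHomology_of_isIsotopic`, `…rasmussenInvariant_eq_of_isIsotopic`.

Everything is proved (conditionally on the hypothesis `hR : Knot.reidemeisterR`); no definition, no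
named fact. Khovanov (2000), Thm. 1; Khovanov (2006), Prop. 6; Rasmussen (2010), Thm. 1.

## References

* M. Khovanov, *A categorification of the Jones polynomial*, Duke Math. J. 101 (2000), Thm. 1.
  [cite: Khovanov2000, Thm. 1]
* M. Khovanov, *Link homology and Frobenius extensions*, Fund. Math. 190 (2006), Prop. 6.
  [cite: Khovanov2006, Prop. 6]
* J. Rasmussen, *Khovanov homology and the slice genus*, Invent. Math. 182 (2010), Thm. 1.
  [cite: Rasmussen2010, Thm. 1]
* K. Reidemeister, *Elementare Begründung der Knotentheorie* (1927); M. Polyak, Quantum Topol. 1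
  (2010), Thm. 1.2. [cite: Reidemeister1927]
-/

open CategoryTheory

noncomputable section

namespace Literature.Topology.FourManifolds

namespace Knot.RegularProjection

variable {K K' : Knot}

/-- **Khovanov homology is a knot invariant** (modulo Reidemeister's theorem `Knot.reidemeisterR`):
regular projections of isotopic knots read Gauss diagrams with isomorphic `Kh^{i,j}`.
Khovanov (2000), Thm. 1. [cite: Khovanov2000, Thm. 1] -/
theorem nonempty_iso_khovanovHomology_of_isIsotopic (hR : Knot.reidemeisterR) (P : K.RegularProjection)
    (P' : K'.RegularProjection) (h : K.IsIsotopic K') (i j : ℤ) :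
    Nonempty (P.diagram.khovanovHomology i j ≅ P'.diagram.khovanovHomology i j) :=
  GaussDiagram.nonempty_iso_khovanovHomology_of_rEquiv ⟨K, P, rfl⟩ ⟨K', P', rfl⟩
    ((hR ⟨P, rfl⟩ ⟨P', rfl⟩).1 h) i j

/-- **The homology over every Frobenius system `(R, h, t)` is a knot invariant** (modulo
`Knot.reidemeisterR`) — in particular Lee homology and Bar-Natan homology. Khovanov (2006), Prop. 6.
[cite: Khovanov2006, Prop. 6] -/
theorem nonempty_iso_frobeniusHomology_of_isIsotopic (hR : Knot.reidemeisterR) (P : K.RegularProjection)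
    (P' : K'.RegularProjection) (h : K.IsIsotopic K') {R : Type} [CommRing R] (hc tc : R) (i : ℤ) :
    Nonempty (P.diagram.frobeniusHomology R hc tc i ≅ P'.diagram.frobeniusHomology R hc tc i) :=
  GaussDiagram.nonempty_iso_frobeniusHomology_of_rEquiv hc tc ⟨K, P, rfl⟩ ⟨K', P', rfl⟩
    ((hR ⟨P, rfl⟩ ⟨P', rfl⟩).1 h) i

/-- **Rasmussen's `s` is a knot invariant** (modulo `Knot.reidemeisterR`): regular projections of
isotopic knots read the same `s`. Rasmussen (2010), Thm. 1. [cite: Rasmussen2010, Thm. 1] -/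
theorem rasmussenInvariant_eq_of_isIsotopic (hR : Knot.reidemeisterR) (P : K.RegularProjection)
    (P' : K'.RegularProjection) (h : K.IsIsotopic K') :
    P.diagram.rasmussenInvariant = P'.diagram.rasmussenInvariant :=
  GaussDiagram.rasmussenInvariant_eq_of_rEquiv_diagram P P' ((hR ⟨P, rfl⟩ ⟨P', rfl⟩).1 h)

end Knot.RegularProjection

/-- Gauss diagrams of isotopic knots have isomorphic Khovanov homology (modulo `Knot.reidemeisterR`).
[cite: Khovanov2000, Thm. 1] -/
theorem Knot.HasGaussDiagram.nonempty_iso_khovanovHomology_of_isIsotopic (hR : Knot.reidemeisterR)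
    {K K' : Knot} {G G' : GaussDiagram} (hG : K.HasGaussDiagram G) (hG' : K'.HasGaussDiagram G')
    (h : K.IsIsotopic K') (i j : ℤ) : Nonempty (G.khovanovHomology i j ≅ G'.khovanovHomology i j) := by
  obtain ⟨P, rfl⟩ := hG
  obtain ⟨P', rfl⟩ := hG'
  exact P.nonempty_iso_khovanovHomology_of_isIsotopic hR P' h i j

/-- Gauss diagrams of isotopic knots have the same Rasmussen invariant (modulo `Knot.reidemeisterR`).
[cite: Rasmussen2010, Thm. 1] -/
theorem Knot.HasGaussDiagram.rasmussenInvariant_eq_of_isIsotopic (hR : Knot.reidemeisterR)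
    {K K' : Knot} {G G' : GaussDiagram} (hG : K.HasGaussDiagram G) (hG' : K'.HasGaussDiagram G')
    (h : K.IsIsotopic K') : G.rasmussenInvariant = G'.rasmussenInvariant := by
  obtain ⟨P, rfl⟩ := hG
  obtain ⟨P', rfl⟩ := hG'
  exact P.rasmussenInvariant_eq_of_isIsotopic hR P' h

end Literature.Topology.FourManifolds
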